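import Summits.Ventures.LatticeQCDFlow.Scaling.SectorExactWitnessTwoSided
import Summits.Ventures.LatticeQCDFlow.Scaling.TwoLevelCycleLaw

/-!
HONEST FRAMING: exact (Metropolis-corrected) sampling algorithms for lattice gauge theory; figures
of merit are autocorrelation/cost numbers at stated couplings and volumes; no continuum-physics
claim.

# TwoLevelCycleWitnessTwoSided — ONE COLD LEVEL, BOTH SIDES ON ANY FINITE `S`: FOR THE QUALITY-`p` SECTOR-STARVED WITNESS (ANY POSITIVE LAW
# `ν`, ANY SECTOR `A`, IDENTITY MAP, EXACT HOT REDRAWS) `(m/(t·c_max·p))·log(2(1−ε−ν(A))) ≤ t_mix(ε) ≤ ⌈(2(2t+h)/(p·t·h))·log(3/ε)⌉`;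
# AT HALF SWAPS `(2/p)·log(2(1−ε−ν(A))) ≤ t_mix(ε) ≤ ⌈(12/p)·log(3/ε)⌉` — `Θ(p⁻¹·log(1/ε))`, NO `|S|`, NO `ν` (lean-2 GEN-31, ours)

Venture-side (OURS).  Cell `lqcd-flow` (pub-lqcd), unit `pub-lqcd-lean-2-g31`, 2026-08-29.  Chapter R, file 6: the two-sided card of
`Scaling/TwoLevelCycleLaw` (R4) on chapter Q's general-`S` witness (`Scaling/SectorExactWitness` ∕ `…TwoSided`, Q7 ∕ Q9): cold law `ν`, hot law
`ν` with the sector `A` starved by the factor `p` (normalised by `Z`), identity map, exact hot redraws, idle cold content, `m ≥ 1` entries on `(0,1)`.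
The lower side is chapter O's general-`S` floor at `K = 1` (Q9, first clause); the upper side is R4 (the witness has one-sided domination `p·μ_1 ≤ μ_0`
because `Z ≤ 1`).  At half swaps the constant `12/p` coincides with Q10's `6(K+1)/p` at `K = 1` (there `t = h`, no extra-`h` regime); the gain of R4 over
the stale-set route is at `t ≠ h`: rate `p·t·h/(2(2t+h))` against Q9's `(th/(2t+h))·min{h·p·c/m, ½}`, i.e. no second factor `h` when `t ≫ h`.

## What is proved

* **`twoLevelCycleWitness_mixingTime_two_sided`** — `|S| ≥ 2`, `A`, `Aᶜ` non-empty, `0 < p ≤ 1`, `0 < t < 1`, `w ≥ 0`, `Σw = 1`, `w_0 > 0`, hub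
  multiplicities `≤ c_max`, `0 < ε`, `ε + ν(A) < 1`:
  **`(m/(t·c_max·p))·log(2(1−ε−ν(A))) ≤ t_mix(ε) ≤ ⌈(2(2t+(1−t)w_0)/(p·t·(1−t)w_0))·log(3/ε)⌉`**.
* **`halfTwoLevelCycleWitness_mixingTime_two_sided`** — at `t = ½`, `w_0 = 1`, all `m` entries on the one cold level (`c_max = m`):
  **`(2/p)·log(2(1−ε−ν(A))) ≤ t_mix(ε) ≤ ⌈(12/p)·log(3/ε)⌉`**.

Reading (no numerics implied): with one cold replica the persistent map-assisted hub mixes from the worst start in `Θ(p⁻¹)` sweeps on ANY finite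
landscape, both constants explicit (`2` below, `12` above at half swaps), nothing else entering.  NOT CLAIMED: `K ≥ 2`; anything measured.  Literature
grade (cell rule): OWN COMPOSITION of Q9 and R4; nothing cited as a fact; no new bib keys.
-/

noncomputable section

open Finset Function Matrix
open Literature.Probability.MarkovChains

namespace Summit.Ventures.LatticeQCDFlow.Scaling

variable {S : Type*} [Fintype S] [DecidableEq S] {m : ℕ} {w : Fin (1 + 1) → ℝ} {t p Z : ℝ} {ν : S → ℝ}

section Witness
variable (κ : Fin m → Fin 1) (A : Finset S)

/-- **BOTH SIDES FOR ONE COLD LEVEL ON ANY FINITE `S`:**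
`(m/(t·c_max·p))·log(2(1−ε−ν(A))) ≤ t_mix(ε) ≤ ⌈(2(2t+h)/(p·t·h))·log(3/ε)⌉`, `h = (1−t)w_0`. [ours] -/
theorem twoLevelCycleWitness_mixingTime_two_sided [Nontrivial S] (hm : 1 ≤ m) (ht0 : 0 < t) (ht1 : t < 1) (hw0 : ∀ k, 0 ≤ w k)
    (hw00 : 0 < w 0) (hw1 : ∑ k, w k = 1) (hν : ∀ u, 0 < ν u) (hν1 : ∑ u, ν u = 1) (hp0 : 0 < p) (hp1 : p ≤ 1) (hAne : A.Nonempty)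
    (hAc : ∃ u, u ∉ A) (hZ : Z = ∑ u, ν u * (if u ∈ A then p else 1))
    {cmax : ℕ} (hcmax : ∀ k : Fin 1, (univ.filter (fun r : Fin m => κ r = k)).card ≤ cmax)
    {ε : ℝ} (hε0 : 0 < ε) (hε : ε + ∑ u ∈ A, ν u < 1) :
    m / (t * cmax * p) * Real.log (2 * (1 - ε - ∑ u ∈ A, ν u))
      ≤ (mixingTime (fun y z : Fin (1 + 1) → S =>
          t * ptGraphSwap (fun (k : Fin (1 + 1)) (u : S) => if k = 0 then ν u * (if u ∈ A then p else 1) / Z else ν u)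
              (fun r : Fin m => (((0 : Fin (1 + 1)), (κ r).succ) : Fin (1 + 1) × Fin (1 + 1))) (fun _ : Fin m => Equiv.refl S) y z
            + (1 - t) * prodKernel w (fun (k : Fin (1 + 1)) (u v : S) =>
                if k = 0 then ν v * (if v ∈ A then p else 1) / Z else (if u = v then (1 : ℝ) else 0)) y z)
          (tensorFun (fun (k : Fin (1 + 1)) (u : S) => if k = 0 then ν u * (if u ∈ A then p else 1) / Z else ν u)) ε : ℝ)
    ∧ mixingTime (fun y z : Fin (1 + 1) → S =>
          t * ptGraphSwap (fun (k : Fin (1 + 1)) (u : S) => if k = 0 then ν u * (if u ∈ A then p else 1) / Z else ν u)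
              (fun r : Fin m => (((0 : Fin (1 + 1)), (κ r).succ) : Fin (1 + 1) × Fin (1 + 1))) (fun _ : Fin m => Equiv.refl S) y z
            + (1 - t) * prodKernel w (fun (k : Fin (1 + 1)) (u v : S) =>
                if k = 0 then ν v * (if v ∈ A then p else 1) / Z else (if u = v then (1 : ℝ) else 0)) y z)
          (tensorFun (fun (k : Fin (1 + 1)) (u : S) => if k = 0 then ν u * (if u ∈ A then p else 1) / Z else ν u)) ε
      ≤ ⌈1 / (p * t * ((1 - t) * w 0) / (2 * (2 * t + (1 - t) * w 0))) * Real.log (3 / ε)⌉₊ := by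
  -- every entry lists the one cold level, so `c = 1 ≤ card` holds for the (vacuous-index-free) multiplicity hypothesis of Q9
  have hc : ∀ p' : Fin 1, 1 ≤ (univ.filter (fun r : Fin m => κ r = p')).card := fun p' => by
    have hall : (univ.filter (fun r : Fin m => κ r = p')) = univ := by
      ext r; simp only [mem_filter, mem_univ, true_and, iff_true]; rw [Fin.eq_zero (κ r), Fin.eq_zero p']
    rw [hall, card_univ, Fintype.card_fin]; exact hm
  have hlow := (sectorWitness_mixingTime_two_sided κ A (K := 1) le_rfl hm ht0 ht1 hw0 hw00 hw1 hν hν1 hp0 hp1 hAne hAc hZ le_rfl hc hcmax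
    hε0 (by simpa using hε)).1
  have hlow' := hlow
  simp only [Nat.cast_one, one_mul, one_add_one_eq_two] at hlow'
  refine ⟨hlow', ?_⟩
  obtain ⟨hZ0, hZ1, hμ, hμ1, -, -, -, -, -⟩ := sectorWitness_basic κ A (K := 1) hν hν1 hp0 hp1 hAne hAc hZ
  have hdom : ∀ u, p * (fun (k : Fin (1 + 1)) (u : S) => if k = 0 then ν u * (if u ∈ A then p else 1) / Z else ν u) 1 ((Equiv.refl S) u)
      ≤ (fun (k : Fin (1 + 1)) (u : S) => if k = 0 then ν u * (if u ∈ A then p else 1) / Z else ν u) 0 u := by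
    intro u
    simp only [Fin.isValue, one_ne_zero, if_false, if_true, Equiv.refl_apply]
    rw [le_div_iff₀ hZ0]
    have hν0 := hν u
    split_ifs
    · nlinarith [mul_le_mul_of_nonneg_left hZ1 (mul_nonneg hp0.le hν0.le)]
    · nlinarith [mul_le_mul_of_nonneg_left hZ1 (mul_nonneg hp0.le hν0.le), mul_le_mul_of_nonneg_right hp1 hν0.le]
  exact twoLevelCycle_mixingTime_le (M := fun (k : Fin (1 + 1)) (u v : S) =>
      if k = 0 then ν v * (if v ∈ A then p else 1) / Z else (if u = v then (1 : ℝ) else 0))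
    κ (Equiv.refl S) hm hμ hμ1 (fun u v => by simp) (fun u v => by
      simp only [Fin.isValue, one_ne_zero, if_false]; exact if_congr eq_comm rfl rfl) hw0 hw00 hw1 ht0 ht1 hp0 hp1 hdom hε0

/-- **THE HALF-SWAP CARD FOR ONE COLD LEVEL** (`t = ½`, `w_0 = 1`, every one of the `m ≥ 1` entries on the cold level):
**`(2/p)·log(2(1−ε−ν(A))) ≤ t_mix(ε) ≤ ⌈(12/p)·log(3/ε)⌉`**. [ours] -/
theorem halfTwoLevelCycleWitness_mixingTime_two_sided [Nontrivial S] (hm : 1 ≤ m) (hw0 : ∀ k, 0 ≤ w k) (hw01 : w 0 = 1)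
    (hw1 : ∑ k, w k = 1) (hν : ∀ u, 0 < ν u) (hν1 : ∑ u, ν u = 1) (hp0 : 0 < p) (hp1 : p ≤ 1) (hAne : A.Nonempty)
    (hAc : ∃ u, u ∉ A) (hZ : Z = ∑ u, ν u * (if u ∈ A then p else 1)) {ε : ℝ} (hε0 : 0 < ε) (hε : ε + ∑ u ∈ A, ν u < 1) :
    2 / p * Real.log (2 * (1 - ε - ∑ u ∈ A, ν u))
      ≤ (mixingTime (fun y z : Fin (1 + 1) → S =>
          (1 / 2 : ℝ) * ptGraphSwap (fun (k : Fin (1 + 1)) (u : S) => if k = 0 then ν u * (if u ∈ A then p else 1) / Z else ν u)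
              (fun r : Fin m => (((0 : Fin (1 + 1)), (κ r).succ) : Fin (1 + 1) × Fin (1 + 1))) (fun _ : Fin m => Equiv.refl S) y z
            + (1 - 1 / 2) * prodKernel w (fun (k : Fin (1 + 1)) (u v : S) =>
                if k = 0 then ν v * (if v ∈ A then p else 1) / Z else (if u = v then (1 : ℝ) else 0)) y z)
          (tensorFun (fun (k : Fin (1 + 1)) (u : S) => if k = 0 then ν u * (if u ∈ A then p else 1) / Z else ν u)) ε : ℝ)
    ∧ mixingTime (fun y z : Fin (1 + 1) → S =>
          (1 / 2 : ℝ) * ptGraphSwap (fun (k : Fin (1 + 1)) (u : S) => if k = 0 then ν u * (if u ∈ A then p else 1) / Z else ν u)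
              (fun r : Fin m => (((0 : Fin (1 + 1)), (κ r).succ) : Fin (1 + 1) × Fin (1 + 1))) (fun _ : Fin m => Equiv.refl S) y z
            + (1 - 1 / 2) * prodKernel w (fun (k : Fin (1 + 1)) (u v : S) =>
                if k = 0 then ν v * (if v ∈ A then p else 1) / Z else (if u = v then (1 : ℝ) else 0)) y z)
          (tensorFun (fun (k : Fin (1 + 1)) (u : S) => if k = 0 then ν u * (if u ∈ A then p else 1) / Z else ν u)) ε
      ≤ ⌈12 / p * Real.log (3 / ε)⌉₊ := by
  have hw00 : 0 < w 0 := by rw [hw01]; exact one_pos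
  have hcmax : ∀ k : Fin 1, (univ.filter (fun r : Fin m => κ r = k)).card ≤ m := fun k =>
    (card_le_univ _).trans (by rw [Fintype.card_fin])
  have h := twoLevelCycleWitness_mixingTime_two_sided κ A hm (by norm_num : (0 : ℝ) < 1 / 2) (by norm_num) hw0 hw00 hw1 hν hν1 hp0 hp1
    hAne hAc hZ hcmax hε0 hε
  have hmpos : (0 : ℝ) < m := Nat.cast_pos.mpr (by omega)
  have hcoef : (m : ℝ) / (1 / 2 * m * p) = 2 / p := by field_simp
  have hrate : 1 / (p * (1 / 2) * ((1 - 1 / 2) * w 0) / (2 * (2 * (1 / 2) + (1 - 1 / 2) * w 0))) = 12 / p := by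
    rw [hw01]; field_simp; norm_num
  rw [hcoef, hrate] at h
  exact h

end Witness

end Summit.Ventures.LatticeQCDFlow.Scaling

end
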